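import Literature.NumberTheory.Transcendental.SchneiderTwoWeierstrassDefs
import Literature.NumberTheory.Transcendental.SchneiderTwoWeierstrassProofs
import Literature.NumberTheory.Transcendental.SchneiderPeriodsProofs
import Literature.NumberTheory.EllipticCurves.IsogenyOfAlgebraicDependenceProofs
import Literature.NumberTheory.EllipticCurves.RealLatticePeriod
import Mathlib.Algebra.Polynomial.Bivariate
import HarnessLib

/-!
# Schneider's theorem for two Weierstrass functions — polynomial form and commensurability

Topic `Literature/NumberTheory/Transcendental` (family `periods`). Last file of the two-lattice
companion of `SchneiderPeriodsAnalytic.lean` / `SchneiderPeriodsProofs.lean`, on top of the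
coefficient form `exists_F₂_eq_zero` of the sibling `SchneiderTwoWeierstrassProofs.lean`
(Th. Schneider, *Arithmetische Untersuchungen elliptischer Integrale*, Math. Ann. 113 (1937) 1–13;
Baker 1975, Ch. 6, Thm 6.1 run as in the proof of Thm 6.3, p. 58, for `℘₁, ℘₁', ℘₂, ℘₂'` at the
points `(r + ½) l` with the second lattice free):

* `exists_bivariate_evalEval_eq` — a non-zero coefficient family `p` of bidegree `≤ (D, D)` is a
  non-zero bivariate polynomial `P ∈ ℂ[X][Y]` with `P(x, y) = ∑ p (i,k) xⁱ yᵏ` (bookkeeping);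
* `exists_polynomial_evalEval_weierstrassP_eq_zero` — **Schneider's theorem for two `℘`'s**: if
  `Λ₁, Λ₂` have algebraic invariants and share a vector `l` with `l/2 ∉ Λ₁ ∪ Λ₂`, then
  `P(℘_{Λ₁}(z), ℘_{Λ₂}(z)) = 0` off `Λ₁ ∪ Λ₂` for some non-zero `P ∈ ℂ[X][Y]`;
* `exists_pos_mul_mem_of_half_period` — hence `m Λ₁ ⊆ Λ₂` for some integer `m ≥ 1`, by the
  tree's soft lemma
  `Literature.NumberTheory.EllipticCurves.exists_pos_nsmul_mem_of_evalEval_eq_zero` (an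
  algebraic dependence between a `Λ₁`-periodic and a `Λ₂`-elliptic function forces
  commensurability; Silverman *AEC* VI.4.1);
* `schneider_twoWeierstrassP_commensurable` — **the main theorem of the series**: two lattices
  with algebraic invariants sharing a NON-ZERO vector `ℓ` are commensurable (`m Λ₁ ⊆ Λ₂`,
  `m ≥ 1`). The half-period hypothesis is removed by the 2-power normalisation
  `ℓ = 2^{k₁} l₁ = 2^{k₂} l₂` (`Schneider1937.exists_eq_two_pow_mul`) and a homothety
  `Λ ↦ 2^j Λ` of one of the lattices (`PeriodPair.mulLeft`; the invariants scale by `2^{-4j}`,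
  `2^{-6j}` and stay algebraic, and `2^j Λ ⊆ Λ`).

What is NOT here: the transcendence machine itself (auxiliary function, Siegel, Schwarz,
Liouville, endgame) — that is `SchneiderTwoWeierstrassDefs.lean` and the sibling files
`SchneiderTwoWeierstrass*.lean`; isogenies of elliptic curves over `ℚ` (see
`IsogenyOfAlgebraicDependenceProofs.lean`); any statement for non-commensurable lattices.
Theorems only (no definitions, no named facts).

## References

* [Baker1975] A. Baker, *Transcendental Number Theory*, CUP 1975, Ch. 6 §§1–5 (Thm 6.1; proof of
  Thm 6.3, p. 58: "`℘(z), ℘(αz), ℘'(z), ℘'(αz)` simultaneously take values in a number field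
  when `z = (r + ½)ω₁` … we conclude that `℘(z)` and `℘(αz)` are algebraically dependent").
* [Schneider1937] Th. Schneider, Math. Ann. 113 (1937), 1–13.
* J. H. Silverman, *The Arithmetic of Elliptic Curves*, 2nd ed., Thm VI.4.1, Cor. VI.5.1.1.
-/

noncomputable section

open Complex Set Finset Polynomial
open _root_.Topology
open scoped PeriodPair Polynomial.Bivariate

namespace Literature.NumberTheory.Transcendental.Schneider1937TwoP

open Literature.NumberTheory.Transcendental.Schneider1937 (nat_mul_mem exists_eq_two_pow_mul)
open Literature.NumberTheory.Transcendental.Chudnovsky (coeff_sum_monomial_fin)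
open Literature.NumberTheory.EllipticCurves (exists_pos_nsmul_mem_of_evalEval_eq_zero)

/-! ### From coefficient families to bivariate polynomials -/

/-- **Bookkeeping**: a non-zero coefficient family `p` of bidegree `≤ (D, D)` defines the non-zero
bivariate polynomial `P = ∑_k (∑_i p(i,k) Xⁱ) Yᵏ ∈ ℂ[X][Y]` with
`P(x, y) = ∑_{i,k} p(i,k) xⁱ yᵏ`. [folklore] -/
theorem exists_bivariate_evalEval_eq {D : ℕ} {p : Fin (D + 1) × Fin (D + 1) → ℂ} (hp : p ≠ 0) :
    ∃ P : ℂ[X][Y], P ≠ 0 ∧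
      ∀ x y : ℂ, P.evalEval x y = ∑ ij, p ij * (x ^ (ij.1 : ℕ) * y ^ (ij.2 : ℕ)) := by
  classical
  refine ⟨∑ k : Fin (D + 1), monomial (k : ℕ) (∑ i : Fin (D + 1), monomial (i : ℕ) (p (i, k))),
    fun h0 => hp ?_, fun x y => ?_⟩
  · funext ik
    obtain ⟨i, k⟩ := ik
    have h1 : ((∑ k : Fin (D + 1), monomial (k : ℕ)
        (∑ i : Fin (D + 1), monomial (i : ℕ) (p (i, k)))).coeff (k : ℕ)).coeff (i : ℕ) =
        ((0 : ℂ[X][Y]).coeff (k : ℕ)).coeff (i : ℕ) := by rw [h0]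
    rw [coeff_sum_monomial_fin, dif_pos k.2, coeff_sum_monomial_fin, dif_pos i.2] at h1
    simpa using h1
  · simp only [Polynomial.evalEval, Polynomial.eval_finsetSum, Polynomial.eval_monomial,
      Polynomial.eval_mul, Polynomial.eval_pow, Polynomial.eval_C, Finset.sum_mul, mul_assoc,
      Fintype.sum_prod_type_right]

/-! ### Schneider's theorem for two Weierstrass functions -/

/-- **Schneider's theorem for two Weierstrass functions, polynomial form** (Schneider 1937;
Baker 1975, Ch. 6, Thm 6.1 applied as in the proof of Thm 6.3, p. 58, with the second lattice
allowed to differ from a CM-multiple of the first). Let `Λ₁, Λ₂` be lattices with algebraic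
invariants `g₂, g₃`, and let `l ∈ Λ₁ ∩ Λ₂` with `l/2 ∉ Λ₁` and `l/2 ∉ Λ₂`. Then `℘_{Λ₁}` and
`℘_{Λ₂}` are algebraically dependent: there is a non-zero `P ∈ ℂ[X][Y]` with
`P(℘_{Λ₁}(z), ℘_{Λ₂}(z)) = 0` for every `z ∉ Λ₁ ∪ Λ₂`. (The four functions
`℘₁, ℘₁', ℘₂, ℘₂'` generate a ring closed under `d/dz` and take the algebraic values
`(e₁, 0, e₂, 0)` at all the points `(r + ½) l`; the coefficient form is the sibling
`exists_F₂_eq_zero`.) [cite: Baker1975, Ch. 6 Thm 6.1, proof of Thm 6.3 p. 58] -/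
theorem exists_polynomial_evalEval_weierstrassP_eq_zero (L₁ L₂ : PeriodPair)
    (h₂ : IsAlgebraic ℚ L₁.g₂) (h₃ : IsAlgebraic ℚ L₁.g₃) (h₂' : IsAlgebraic ℚ L₂.g₂)
    (h₃' : IsAlgebraic ℚ L₂.g₃) {l : ℂ} (hl₁ : l ∈ L₁.lattice) (hl₂ : l ∈ L₂.lattice)
    (hl2₁ : l / 2 ∉ L₁.lattice) (hl2₂ : l / 2 ∉ L₂.lattice) :
    ∃ P : ℂ[X][Y], P ≠ 0 ∧
      ∀ z, z ∉ L₁.lattice → z ∉ L₂.lattice → P.evalEval (℘[L₁] z) (℘[L₂] z) = 0 := by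
  obtain ⟨D, p, hp, hF⟩ := exists_F₂_eq_zero L₁ L₂ h₂ h₃ h₂' h₃' hl₁ hl₂ hl2₁ hl2₂
  obtain ⟨P, hP, hPe⟩ := exists_bivariate_evalEval_eq hp
  exact ⟨P, hP, fun z hz₁ hz₂ => by rw [hPe]; exact hF z hz₁ hz₂⟩

/-- **Commensurability from a common vector with `l/2 ∉ Λ₁ ∪ Λ₂`.** If `Λ₁, Λ₂` have algebraic
invariants and share a vector `l` with `l/2 ∉ Λ₁`, `l/2 ∉ Λ₂`, then `m Λ₁ ⊆ Λ₂` for some integer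
`m ≥ 1`: the algebraic dependence `P(℘_{Λ₁}, ℘_{Λ₂}) = 0` of
`exists_polynomial_evalEval_weierstrassP_eq_zero` is fed to the soft lemma
`exists_pos_nsmul_mem_of_evalEval_eq_zero` (`℘_{Λ₁}` is `Λ₁`-periodic with countable fibres,
`℘_{Λ₂}` has finitely many fibres modulo `Λ₂`; Silverman *AEC* VI.4.1).
[cite: Baker1975, Ch. 6 Thm 6.1, proof of Thm 6.3 p. 58] -/
theorem exists_pos_mul_mem_of_half_period (L₁ L₂ : PeriodPair) (h₂ : IsAlgebraic ℚ L₁.g₂)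
    (h₃ : IsAlgebraic ℚ L₁.g₃) (h₂' : IsAlgebraic ℚ L₂.g₂) (h₃' : IsAlgebraic ℚ L₂.g₃) {l : ℂ}
    (hl₁ : l ∈ L₁.lattice) (hl₂ : l ∈ L₂.lattice) (hl2₁ : l / 2 ∉ L₁.lattice)
    (hl2₂ : l / 2 ∉ L₂.lattice) :
    ∃ m : ℕ, 0 < m ∧ ∀ z ∈ L₁.lattice, (m : ℂ) * z ∈ L₂.lattice := by
  obtain ⟨P, hP, hPz⟩ :=
    exists_polynomial_evalEval_weierstrassP_eq_zero L₁ L₂ h₂ h₃ h₂' h₃' hl₁ hl₂ hl2₁ hl2₂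
  obtain ⟨m, hm, hle⟩ := exists_pos_nsmul_mem_of_evalEval_eq_zero
    (Λ₁ := L₁.lattice.toAddSubgroup) (Λ₂ := L₂.lattice.toAddSubgroup) (f₁ := ℘[L₁])
    (f₂ := ℘[L₂]) (PeriodPair.countable_lattice L₁)
    (fun ω hω z ↦ L₁.weierstrassP_add_coe z ⟨ω, hω⟩)
    (PeriodPair.countable_preimage_weierstrassP_singleton L₁)
    (PeriodPair.exists_finite_weierstrassP_fibre_mod_lattice L₂)
    (D := (L₁.lattice : Set ℂ) ∪ L₂.lattice) (L₁.countable_lattice.union L₂.countable_lattice)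
    hP (fun z hz ↦ hPz z (fun h ↦ hz (Or.inl h)) (fun h ↦ hz (Or.inr h)))
  refine ⟨m, hm, fun z hz ↦ ?_⟩
  have h1 := hle z hz
  rwa [Submodule.mem_toAddSubgroup, nsmul_eq_mul] at h1

/-! ### The 2-power normalisation -/

/-- `2^j Λ ⊆ Λ`: a vector of the homothetic lattice `2^j Λ` lies in `Λ`. [folklore] -/
lemma mem_lattice_of_mem_mulLeft_two_pow (L : PeriodPair) (j : ℕ) (hc : (2 : ℂ) ^ j ≠ 0)
    {x : ℂ} (hx : x ∈ (L.mulLeft (2 ^ j) hc).lattice) : x ∈ L.lattice := by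
  have h := nat_mul_mem (PeriodPair.mem_mulLeft_lattice.mp hx) (2 ^ j)
  push_cast at h
  rwa [mul_inv_cancel_left₀ hc] at h

/-- The invariants `g₂(2^j Λ) = 2^{-4j} g₂(Λ)`, `g₃(2^j Λ) = 2^{-6j} g₃(Λ)` of the homothetic
lattice `2^j Λ` are algebraic when those of `Λ` are. [folklore] -/
lemma isAlgebraic_g₂_g₃_mulLeft_two_pow (L : PeriodPair) (j : ℕ) (hc : (2 : ℂ) ^ j ≠ 0)
    (h₂ : IsAlgebraic ℚ L.g₂) (h₃ : IsAlgebraic ℚ L.g₃) :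
    IsAlgebraic ℚ (L.mulLeft (2 ^ j) hc).g₂ ∧ IsAlgebraic ℚ (L.mulLeft (2 ^ j) hc).g₃ := by
  have key : ∀ (n : ℕ) {x : ℂ}, IsAlgebraic ℚ x →
      IsAlgebraic ℚ ((((2 : ℂ) ^ j) ^ n)⁻¹ * x) := by
    intro n x hx
    have h2 : IsIntegral ℚ ((((2 : ℂ) ^ j) ^ n)⁻¹) := by
      have : (((2 : ℂ) ^ j) ^ n)⁻¹ = algebraMap ℚ ℂ ((((2 : ℚ) ^ j) ^ n)⁻¹) := by
        push_cast; rfl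
      rw [this]
      exact isIntegral_algebraMap
    exact (h2.mul hx.isIntegral).isAlgebraic
  exact ⟨by rw [PeriodPair.g₂_mulLeft]; exact key 4 h₂,
    by rw [PeriodPair.g₃_mulLeft]; exact key 6 h₃⟩

/-- **Schneider's theorem for two Weierstrass functions — commensurability form** (the statement
consumed downstream). Let `Λ₁, Λ₂ ⊂ ℂ` be lattices whose invariants `g₂, g₃` are algebraic, and
suppose `Λ₁ ∩ Λ₂` contains a non-zero vector `ℓ`. Then `Λ₁` and `Λ₂` are commensurable: there
is an integer `m ≥ 1` with `m Λ₁ ⊆ Λ₂`.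

Proof: write `ℓ = 2^{k₁} l₁ = 2^{k₂} l₂` with `lᵢ ∈ Λᵢ`, `lᵢ/2 ∉ Λᵢ`
(`Schneider1937.exists_eq_two_pow_mul`). If `k₁ ≤ k₂` then `l₁ = 2^{k₂-k₁} l₂` is a vector
of `Λ₁` and of `Λ₂' = 2^{k₂-k₁} Λ₂` with `l₁/2` in neither, the invariants of `Λ₂'` are
algebraic, and `exists_pos_mul_mem_of_half_period` gives `m Λ₁ ⊆ Λ₂' ⊆ Λ₂`; if `k₂ < k₁`,
symmetrically `m (2^{k₁-k₂} Λ₁) ⊆ Λ₂`. (Schneider 1937; Baker 1975, Ch. 6, proof of Thm 6.3,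
p. 58, with a free second lattice; the passage from algebraic dependence to `m Λ₁ ⊆ Λ₂` is
Silverman *AEC* VI.4.1.) [cite: Baker1975, Ch. 6 Thm 6.1, proof of Thm 6.3 p. 58] -/
theorem schneider_twoWeierstrassP_commensurable (L₁ L₂ : PeriodPair) (h₂ : IsAlgebraic ℚ L₁.g₂)
    (h₃ : IsAlgebraic ℚ L₁.g₃) (h₂' : IsAlgebraic ℚ L₂.g₂) (h₃' : IsAlgebraic ℚ L₂.g₃)
    (hℓ : ∃ ℓ : ℂ, ℓ ≠ 0 ∧ ℓ ∈ L₁.lattice ∧ ℓ ∈ L₂.lattice) :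
    ∃ m : ℕ, 0 < m ∧ ∀ z ∈ L₁.lattice, (m : ℂ) * z ∈ L₂.lattice := by
  obtain ⟨ℓ, hℓ0, hℓ₁, hℓ₂⟩ := hℓ
  obtain ⟨k₁, l₁, hl₁, hl₁2, e₁⟩ := exists_eq_two_pow_mul L₁ hℓ₁ hℓ0
  obtain ⟨k₂, l₂, hl₂, hl₂2, e₂⟩ := exists_eq_two_pow_mul L₂ hℓ₂ hℓ0
  rcases le_or_gt k₁ k₂ with hk | hk
  · -- `l₁ = 2^{k₂-k₁} l₂`; scale `Λ₂`.
    have hc : (2 : ℂ) ^ (k₂ - k₁) ≠ 0 := pow_ne_zero _ two_ne_zero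
    have hl₁c : l₁ = 2 ^ (k₂ - k₁) * l₂ := by
      apply mul_left_cancel₀ (pow_ne_zero k₁ (two_ne_zero (α := ℂ)))
      rw [← e₁, e₂, ← mul_assoc, ← pow_add, Nat.add_sub_of_le hk]
    have hl₁' : l₁ ∈ (L₂.mulLeft (2 ^ (k₂ - k₁)) hc).lattice := by
      rw [hl₁c]; exact PeriodPair.mul_mem_mulLeft_lattice.mpr hl₂
    have hl₁2' : l₁ / 2 ∉ (L₂.mulLeft (2 ^ (k₂ - k₁)) hc).lattice := by
      rw [hl₁c, mul_div_assoc]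
      exact fun h => hl₂2 (PeriodPair.mul_mem_mulLeft_lattice.mp h)
    obtain ⟨ha₂, ha₃⟩ := isAlgebraic_g₂_g₃_mulLeft_two_pow L₂ (k₂ - k₁) hc h₂' h₃'
    obtain ⟨m, hm, hmz⟩ :=
      exists_pos_mul_mem_of_half_period L₁ _ h₂ h₃ ha₂ ha₃ hl₁ hl₁' hl₁2 hl₁2'
    exact ⟨m, hm, fun z hz => mem_lattice_of_mem_mulLeft_two_pow L₂ (k₂ - k₁) hc (hmz z hz)⟩
  · -- `l₂ = 2^{k₁-k₂} l₁`; scale `Λ₁`.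
    have hc : (2 : ℂ) ^ (k₁ - k₂) ≠ 0 := pow_ne_zero _ two_ne_zero
    have hl₂c : l₂ = 2 ^ (k₁ - k₂) * l₁ := by
      apply mul_left_cancel₀ (pow_ne_zero k₂ (two_ne_zero (α := ℂ)))
      rw [← e₂, e₁, ← mul_assoc, ← pow_add, Nat.add_sub_of_le hk.le]
    have hl₂' : l₂ ∈ (L₁.mulLeft (2 ^ (k₁ - k₂)) hc).lattice := by
      rw [hl₂c]; exact PeriodPair.mul_mem_mulLeft_lattice.mpr hl₁
    have hl₂2' : l₂ / 2 ∉ (L₁.mulLeft (2 ^ (k₁ - k₂)) hc).lattice := by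
      rw [hl₂c, mul_div_assoc]
      exact fun h => hl₁2 (PeriodPair.mul_mem_mulLeft_lattice.mp h)
    obtain ⟨ha₂, ha₃⟩ := isAlgebraic_g₂_g₃_mulLeft_two_pow L₁ (k₁ - k₂) hc h₂ h₃
    obtain ⟨m, hm, hmz⟩ :=
      exists_pos_mul_mem_of_half_period _ L₂ ha₂ ha₃ h₂' h₃' hl₂' hl₂ hl₂2' hl₂2
    refine ⟨m * 2 ^ (k₁ - k₂), Nat.mul_pos hm (pow_pos two_pos _), fun z hz => ?_⟩
    have h1 := hmz (2 ^ (k₁ - k₂) * z) (PeriodPair.mul_mem_mulLeft_lattice.mpr hz)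
    push_cast
    rwa [mul_assoc]

end Literature.NumberTheory.Transcendental.Schneider1937TwoP

end
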